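import Summits.SmoothPoincare4.SmoothPoincare4.Theorems.ConvexBisectionAcyclicBisectionExistsDualHandleModelEmbDom
import HarnessLib

/-!
# Dual handles, XIV: the differential of the model of the dual handle embedding
(brick (F-emb-b) of the sub-goal T3b "the complement of the prefix sub-handlebody is the other
piece with the DUAL suffix handles" of stub `stub_steinRealisation` (NF6), line `modp-braid-orbits`
r11, crux `ConvexBisection.AcyclicBisectionExists`, item stmt-SmoothPoincare4-10508; wave 3, lead c5)

Sequel of `…DualHandleModelEmbDom.lean`.  The model `𝓕 z = A(z) z_μ ⊕ B(z) z_λ` of the dual handle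
embedding (`A = √(𝓅(s)/(1-s))`, `B = √(q̃(s,u))`, `s = ‖z_λ‖²`, `u = ‖z_μ‖²/(1-s)`; the `λ`-part of
`𝓕 z` is along `z_μ`, the `μ`-part along `z_λ`) has the differential

    d𝓕_z v = (A v_μ + (dA v) z_μ) ⊕ (B v_λ + (dB v) z_λ)      (`hasFDerivAt_modelF`),

so a kernel vector has parts PARALLEL to those of `z`: `v_μ = c_μ z_μ`, `v_λ = c_λ z_λ`
(`parts_of_ker`).  Along such a direction the squared part-norms `P = ‖(𝓕 ·)_λ‖² = u 𝓅(s)` and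
`Q = ‖(𝓕 ·)_μ‖² = s q̃(s,u)` of `…ModelInj.lean` are stationary (`hasDerivAt_parts_of_ker`), while
`s(z + t v) = (1 + t c_λ)² s` and `‖(z + t v)_μ‖² = (1 + t c_μ)² ‖z_μ‖²` — the one-variable
identities from which the next file (`…DualHandleModelEmbedding.lean`) extracts `c_λ s = 0` and then `v = 0`, i.e. the
INJECTIVITY OF THE DIFFERENTIAL.  Also here: the one-dimensional calculus of the profiles
(`hasDerivAt_gProfile`, `g' = a/(2(1-t)²) > 0`; `deriv shellCut ≥ 0`) and the conclusion of the
kernel argument once `c_λ s = 0` is known (`ker_eq_zero_of_mul_eq_zero`).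

* `helper_parts_of_ker_fderiv_modelF` (registered).

Everything here is proved; no named facts.

## References
* J. Milnor, *Lectures on the h-cobordism theorem* (1965), §3. [MilnorHCobordism1965]
* A. A. Kosinski, *Differential Manifolds* (1993), VI §6. [Kosinski1993]
-/

noncomputable section

-- the prescribed namespace `Summit.<P>.<Sub>.…` duplicates `SmoothPoincare4` (P = Sub)
set_option linter.dupNamespace false

open scoped Manifold ContDiff Topology

namespace Summit.SmoothPoincare4.SmoothPoincare4.Theorems.AcyclicBisectionExists.ModpBraidOrbits

open Set Function Metric Filter
open Literature.Topology.FourManifolds Literature.Topology.FourManifolds.HandleAttachingMap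

/-! ### §1 Linear algebra of the splitting and one-variable calculus of the profiles -/

section Calculus

/-- `lamEmbed` is additive. [folklore] -/
theorem lamEmbed_add (u w : EuclideanSpace ℝ (Fin 2)) : lamEmbed (u + w) = lamEmbed u + lamEmbed w := by
  ext i; fin_cases i <;> simp

/-- `lamEmbed 0 = 0`. [folklore] -/
@[simp] theorem lamEmbed_zero : lamEmbed 0 = 0 := by
  ext i; fin_cases i <;> simp

/-- `‖x_λ‖ ≤ ‖x‖`. [folklore] -/
theorem norm_lamPart_le (x : EuclideanSpace ℝ (Fin 4)) : ‖lamPart x‖ ≤ ‖x‖ := by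
  have h := norm_sq_eq_lamPart_muPart x
  nlinarith [norm_nonneg x, norm_nonneg (lamPart x), sq_nonneg ‖muPart x‖]

/-- `‖x_μ‖ ≤ ‖x‖`. [folklore] -/
theorem norm_muPart_le (x : EuclideanSpace ℝ (Fin 4)) : ‖muPart x‖ ≤ ‖x‖ := by
  have h := norm_sq_eq_lamPart_muPart x
  nlinarith [norm_nonneg x, norm_nonneg (muPart x), sq_nonneg ‖lamPart x‖]

/-- `lamPart` is a bounded linear map. [folklore] -/
theorem isBoundedLinearMap_lamPart :
    IsBoundedLinearMap ℝ (lamPart : EuclideanSpace ℝ (Fin 4) → EuclideanSpace ℝ (Fin 2)) :=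
  IsLinearMap.with_bound ⟨lamPart_add, lamPart_smul⟩ 1 fun x => by
    rw [one_mul]; exact norm_lamPart_le x

/-- `muPart` is a bounded linear map. [folklore] -/
theorem isBoundedLinearMap_muPart :
    IsBoundedLinearMap ℝ (muPart : EuclideanSpace ℝ (Fin 4) → EuclideanSpace ℝ (Fin 2)) :=
  IsLinearMap.with_bound ⟨muPart_add, muPart_smul⟩ 1 fun x => by
    rw [one_mul]; exact norm_muPart_le x

/-- `z ↦ (z_μ, 0)` (the `λ`-slot filled with the `μ`-part) is a bounded linear map. [folklore] -/
theorem isBoundedLinearMap_lamEmbed_muPart :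
    IsBoundedLinearMap ℝ (fun z : EuclideanSpace ℝ (Fin 4) => lamEmbed (muPart z)) :=
  IsLinearMap.with_bound
    ⟨fun x y => by rw [muPart_add, lamEmbed_add], fun c x => by rw [muPart_smul, lamEmbed_smul]⟩ 1
    fun x => by rw [one_mul, norm_lamEmbed]; exact norm_muPart_le x

/-- `z ↦ (0, z_λ)` (the `μ`-slot filled with the `λ`-part) is a bounded linear map. [folklore] -/
theorem isBoundedLinearMap_muEmbed_lamPart :
    IsBoundedLinearMap ℝ (fun z : EuclideanSpace ℝ (Fin 4) => muEmbed (lamPart z)) :=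
  IsLinearMap.with_bound
    ⟨fun x y => by rw [lamPart_add, muEmbed_add], fun c x => by rw [lamPart_smul, muEmbed_smul]⟩ 1
    fun x => by rw [one_mul, norm_muEmbed]; exact norm_lamPart_le x

/-- **`g' = a / (2 (1-t)²)`** off `t = 1`. [folklore] -/
theorem hasDerivAt_gProfile (a : ℝ) {t : ℝ} (ht : t ≠ 1) :
    HasDerivAt (gProfile a) (a / (2 * (1 - t) ^ 2)) t := by
  have h1t : (1 - t) ≠ 0 := sub_ne_zero.2 (Ne.symm ht)
  have h1 : HasDerivAt (fun x : ℝ => a * x) (a * 1) t := (hasDerivAt_id t).const_mul a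
  have h2 : HasDerivAt (fun x : ℝ => 2 * (1 - x)) (2 * (-1)) t :=
    ((hasDerivAt_id t).const_sub 1).const_mul 2
  have hne : 2 * (1 - t) ≠ 0 := mul_ne_zero two_ne_zero h1t
  have h := h1.fun_div h2 hne
  have hfun : gProfile a = fun x => a * x / (2 * (1 - x)) := rfl
  rw [hfun]
  refine h.congr_deriv ?_
  field_simp
  ring

/-- `g' > 0` (`0 < a`, `t ≠ 1`). [folklore] -/
theorem gProfile_deriv_pos {a t : ℝ} (ha : 0 < a) (ht : t < 1) : 0 < a / (2 * (1 - t) ^ 2) :=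
  div_pos ha (mul_pos two_pos (pow_pos (by linarith) 2))

/-- `ω = shellCut` is differentiable with non-negative derivative (it is monotone). [folklore] -/
theorem hasDerivAt_shellCut (s : ℝ) :
    HasDerivAt shellCut (deriv shellCut s) s ∧ 0 ≤ deriv shellCut s :=
  ⟨((contDiff_cutTop.differentiable (by simp)).differentiableAt).hasDerivAt,
    Monotone.deriv_nonneg fun _ _ h => shellCut_mono h⟩

end Calculus

/-! ### §2 The structure of the differential of `𝓕` -/

section Structure

/-- **THE DIFFERENTIAL OF `𝓕`.**  At a point of `modelDom` (`0 < κ`, `0 < δ ≤ 1/2`) the model map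
has a derivative `F'` whose parts are `(F' v)_λ = A v_μ + (A' v) z_μ`, `(F' v)_μ = B v_λ + (B' v) z_λ`
for some linear forms `A'`, `B'` (the differentials of the smooth positive coefficients
`A = √(𝓅(s)/(1-s))`, `B = √(q̃(s,u))`; product rule). [folklore] -/
theorem hasFDerivAt_modelF {a κ δ : ℝ} (hκ : 0 < κ) (hδ : 0 < δ) (hδ2 : δ ≤ 1 / 2)
    {z : EuclideanSpace ℝ (Fin 4)} (hz : z ∈ modelDom a κ δ) :
    ∃ F' : EuclideanSpace ℝ (Fin 4) →L[ℝ] EuclideanSpace ℝ (Fin 4),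
      HasFDerivAt (modelF a κ δ) F' z ∧
      ∃ A' B' : EuclideanSpace ℝ (Fin 4) →L[ℝ] ℝ, ∀ v,
        lamPart (F' v) = Real.sqrt (pFun κ (sOf z) / (1 - sOf z)) • muPart v + A' v • muPart z ∧
        muPart (F' v) = Real.sqrt (qTilde a κ δ (sOf z) (uOf z)) • lamPart v + B' v • lamPart z := by
  set A : EuclideanSpace ℝ (Fin 4) → ℝ := fun x => Real.sqrt (pFun κ (sOf x) / (1 - sOf x)) with hA
  set B : EuclideanSpace ℝ (Fin 4) → ℝ := fun x => Real.sqrt (qTilde a κ δ (sOf x) (uOf x)) with hB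
  have hsub : modelDom a κ δ ⊆ {z | sOf z < 1} := fun z hz => hz.1
  -- smoothness of the coefficients (as in `contDiffOn_modelF`)
  have hAs : ContDiffOn ℝ ∞ A (modelDom a κ δ) := by
    refine ContDiffOn.sqrt (ContDiffOn.div ((contDiff_pFun κ).comp contDiff_sOf).contDiffOn
      (contDiffOn_const.sub contDiff_sOf.contDiffOn) fun z hz => sub_ne_zero.2 (ne_of_gt hz.1))
      fun z hz => ?_
    exact (div_pos (pFun_pos hκ (sq_nonneg _)) (by linarith [hz.1])).ne'
  have hF : ContDiffOn ℝ ∞ (fun z => FTop a κ δ (sOf z) (uOf z)) {z | sOf z < 1} := by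
    unfold FTop
    have harg : ContDiffOn ℝ ∞ (fun z => δ * (sOf z * (1 - uOf z))) {z | sOf z < 1} :=
      contDiffOn_const.mul (contDiff_sOf.contDiffOn.mul (contDiffOn_const.sub contDiffOn_uOf))
    exact (contDiffOn_const.add ((contDiffOn_gProfile a).comp harg fun z hz => arg_lt_one hδ hδ2 hz)).sub
      (contDiffOn_const.mul (contDiff_sOf.contDiffOn.mul contDiffOn_uOf))
  have hBs : ContDiffOn ℝ ∞ B (modelDom a κ δ) := by
    refine ContDiffOn.sqrt ?_ fun z hz => hz.2.ne'
    unfold qTilde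
    exact (((contDiff_cutTopDiv.comp contDiff_sOf).contDiffOn.mono hsub).mul (hF.mono hsub)).add
      ((contDiffOn_const.sub ((contDiff_cutTop.comp contDiff_sOf).contDiffOn.mono hsub)).mul
        contDiffOn_const)
  have hnhds : modelDom a κ δ ∈ 𝓝 z := (isOpen_modelDom hκ hδ hδ2).mem_nhds hz
  have hAd : HasFDerivAt A (fderiv ℝ A z) z :=
    ((hAs.contDiffAt hnhds).differentiableAt (by simp)).hasFDerivAt
  have hBd : HasFDerivAt B (fderiv ℝ B z) z :=
    ((hBs.contDiffAt hnhds).differentiableAt (by simp)).hasFDerivAt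
  have hL1 := (isBoundedLinearMap_lamEmbed_muPart).hasFDerivAt (x := z)
  have hL2 := (isBoundedLinearMap_muEmbed_lamPart).hasFDerivAt (x := z)
  have hFd := (hAd.smul hL1).add (hBd.smul hL2)
  refine ⟨_, hFd, fderiv ℝ A z, fderiv ℝ B z, fun v => ⟨?_, ?_⟩⟩
  · show lamPart (A z • lamEmbed (muPart v) + fderiv ℝ A z v • lamEmbed (muPart z) +
      (B z • muEmbed (lamPart v) + fderiv ℝ B z v • muEmbed (lamPart z))) = _
    rw [lamPart_add, lamPart_add, lamPart_add, lamPart_smul, lamPart_smul, lamPart_smul, lamPart_smul,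
      lamPart_lamEmbed, lamPart_lamEmbed, lamPart_muEmbed, lamPart_muEmbed, smul_zero, smul_zero,
      add_zero, add_zero]
  · show muPart (A z • lamEmbed (muPart v) + fderiv ℝ A z v • lamEmbed (muPart z) +
      (B z • muEmbed (lamPart v) + fderiv ℝ B z v • muEmbed (lamPart z))) = _
    rw [muPart_add, muPart_add, muPart_add, muPart_smul, muPart_smul, muPart_smul, muPart_smul,
      muPart_lamEmbed, muPart_lamEmbed, muPart_muEmbed, muPart_muEmbed, smul_zero, smul_zero,
      zero_add, zero_add]

end Structure

/-! ### §3 Kernel vectors of the differential -/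

section Kernel

/-- From `A • x + c • y = 0` with `A ≠ 0`: `x = (A⁻¹ · (-c)) • y`. [folklore] -/
theorem eq_smul_of_smul_add_smul_eq_zero {A c : ℝ} {x y : EuclideanSpace ℝ (Fin 2)} (hA : A ≠ 0)
    (h : A • x + c • y = 0) : x = (A⁻¹ * -c) • y := by
  have h1 : A • x = (-c) • y := by rw [neg_smul]; exact eq_neg_of_add_eq_zero_left h
  calc x = A⁻¹ • (A • x) := by rw [smul_smul, inv_mul_cancel₀ hA, one_smul]
    _ = (A⁻¹ * -c) • y := by rw [h1, smul_smul]

/-- **KERNEL VECTORS OF `d𝓕_z` HAVE PARTS PARALLEL TO THOSE OF `z`**: if `F' v = 0` for the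
derivative `F'` of `𝓕` at `z ∈ modelDom`, then `v_λ = c_λ z_λ` and `v_μ = c_μ z_μ` (the
coefficients `A, B > 0` of the structure formula are invertible). [folklore] -/
theorem parts_of_ker {a κ δ : ℝ} (hκ : 0 < κ) (hδ : 0 < δ) (hδ2 : δ ≤ 1 / 2)
    {z : EuclideanSpace ℝ (Fin 4)} (hz : z ∈ modelDom a κ δ)
    {F' : EuclideanSpace ℝ (Fin 4) →L[ℝ] EuclideanSpace ℝ (Fin 4)}
    (hF : HasFDerivAt (modelF a κ δ) F' z) {v : EuclideanSpace ℝ (Fin 4)} (hv : F' v = 0) :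
    ∃ cl cm : ℝ, lamPart v = cl • lamPart z ∧ muPart v = cm • muPart z := by
  obtain ⟨F₁, hF₁, A', B', hparts⟩ := hasFDerivAt_modelF hκ hδ hδ2 hz
  have hFF : F₁ = F' := hF₁.unique hF
  obtain ⟨hl, hm⟩ := hparts v
  rw [hFF, hv] at hl hm
  rw [isBoundedLinearMap_lamPart.toIsLinearMap.map_zero] at hl
  rw [isBoundedLinearMap_muPart.toIsLinearMap.map_zero] at hm
  have hA : Real.sqrt (pFun κ (sOf z) / (1 - sOf z)) ≠ 0 :=
    (Real.sqrt_pos.2 (div_pos (pFun_pos hκ (sq_nonneg _)) (by linarith [hz.1]))).ne'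
  have hB : Real.sqrt (qTilde a κ δ (sOf z) (uOf z)) ≠ 0 := (Real.sqrt_pos.2 hz.2).ne'
  exact ⟨_, _, eq_smul_of_smul_add_smul_eq_zero hB hm.symm, eq_smul_of_smul_add_smul_eq_zero hA hl.symm⟩

/-- `s` along the line `z + t v` when `v_λ = c_λ z_λ`: `s(z + t v) = (1 + t c_λ)² s(z)`. [folklore] -/
theorem sOf_line {z v : EuclideanSpace ℝ (Fin 4)} {cl : ℝ} (hvl : lamPart v = cl • lamPart z) (t : ℝ) :
    sOf (z + t • v) = (1 + t * cl) ^ 2 * sOf z := by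
  unfold sOf
  rw [lamPart_add, lamPart_smul, hvl, smul_smul,
    show lamPart z + (t * cl) • lamPart z = (1 + t * cl) • lamPart z by rw [add_smul, one_smul],
    norm_smul, mul_pow, Real.norm_eq_abs, sq_abs]

/-- `‖(z + t v)_μ‖² = (1 + t c_μ)² ‖z_μ‖²` when `v_μ = c_μ z_μ`. [folklore] -/
theorem normSq_muPart_line {z v : EuclideanSpace ℝ (Fin 4)} {cm : ℝ} (hvm : muPart v = cm • muPart z)
    (t : ℝ) : ‖muPart (z + t • v)‖ ^ 2 = (1 + t * cm) ^ 2 * ‖muPart z‖ ^ 2 := by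
  rw [muPart_add, muPart_smul, hvm, smul_smul,
    show muPart z + (t * cm) • muPart z = (1 + t * cm) • muPart z by rw [add_smul, one_smul],
    norm_smul, mul_pow, Real.norm_eq_abs, sq_abs]

/-- **Along a kernel direction the squared part-norms of `𝓕` are stationary**: if `F' v = 0`
then `t ↦ ‖(𝓕 (z + t v))_λ‖²` and `t ↦ ‖(𝓕 (z + t v))_μ‖²` have derivative `0` at `t = 0` (chain
rule). [folklore] -/
theorem hasDerivAt_parts_of_ker {a κ δ : ℝ} {z : EuclideanSpace ℝ (Fin 4)}
    {F' : EuclideanSpace ℝ (Fin 4) →L[ℝ] EuclideanSpace ℝ (Fin 4)}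
    (hF : HasFDerivAt (modelF a κ δ) F' z) {v : EuclideanSpace ℝ (Fin 4)} (hv : F' v = 0) :
    HasDerivAt (fun t : ℝ => ‖lamPart (modelF a κ δ (z + t • v))‖ ^ 2) 0 0 ∧
      HasDerivAt (fun t : ℝ => ‖muPart (modelF a κ δ (z + t • v))‖ ^ 2) 0 0 := by
  have hγ : HasDerivAt (fun t : ℝ => z + t • v) v 0 := by
    have h := ((hasDerivAt_id' (0 : ℝ)).smul_const v).const_add z
    rwa [one_smul] at h
  have h0 : (fun t : ℝ => z + t • v) 0 = z := by simp
  have hF0 : HasFDerivAt (modelF a κ δ) F' ((fun t : ℝ => z + t • v) 0) := by rw [h0]; exact hF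
  have hFγ := hF0.comp_hasDerivAt (0 : ℝ) hγ
  have h1 := ((isBoundedLinearMap_lamPart.hasFDerivAt).comp_hasDerivAt (0 : ℝ) hFγ).norm_sq
  have h2 := ((isBoundedLinearMap_muPart.hasFDerivAt).comp_hasDerivAt (0 : ℝ) hFγ).norm_sq
  rw [hv, map_zero, inner_zero_right, mul_zero] at h1 h2
  exact ⟨h1, h2⟩

/-- **End of the kernel argument.**  If a kernel vector `v` of `d𝓕_z` (`s(z) < 1`, `0 < κ`) has
parts `v_λ = c_λ z_λ`, `v_μ = c_μ z_μ` with `c_λ s(z) = 0`, then `v = 0`: `v_λ = 0`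
(`‖v_λ‖² = c_λ (c_λ s)`); `s` is constant along `z + t v`, so
`‖(𝓕 (z + t v))_λ‖² = (1 + t c_μ)² ‖z_μ‖² 𝓅(s)/(1-s)` has derivative `2 c_μ ‖z_μ‖² 𝓅(s)/(1-s) = 0`
at `t = 0`, whence `c_μ ‖z_μ‖² = 0` and `v_μ = 0`. [folklore] -/
theorem ker_eq_zero_of_mul_eq_zero {a κ δ : ℝ} (hκ : 0 < κ) {z : EuclideanSpace ℝ (Fin 4)}
    (hs1 : sOf z < 1) {F' : EuclideanSpace ℝ (Fin 4) →L[ℝ] EuclideanSpace ℝ (Fin 4)}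
    (hF : HasFDerivAt (modelF a κ δ) F' z) {v : EuclideanSpace ℝ (Fin 4)} (hv : F' v = 0)
    {cl cm : ℝ} (hvl : lamPart v = cl • lamPart z) (hvm : muPart v = cm • muPart z)
    (h0 : cl * sOf z = 0) : v = 0 := by
  -- `v_λ = 0`
  have hl : lamPart v = 0 := by
    have h : ‖lamPart v‖ ^ 2 = 0 := by
      rw [hvl, norm_smul, mul_pow, Real.norm_eq_abs, sq_abs]
      have e : cl ^ 2 * ‖lamPart z‖ ^ 2 = cl * (cl * sOf z) := by unfold sOf; ring
      rw [e, h0, mul_zero]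
    exact norm_eq_zero.1 ((pow_eq_zero_iff two_ne_zero).1 h)
  -- `s` is constant along the line
  have hs : ∀ t : ℝ, sOf (z + t • v) = sOf z := fun t => by
    rw [sOf_line hvl]; linear_combination (2 * t + t ^ 2 * cl) * h0
  -- the `λ`-norm of `𝓕` along the line and its derivative
  have hP : ∀ t : ℝ, ‖lamPart (modelF a κ δ (z + t • v))‖ ^ 2 =
      (1 + t * cm) ^ 2 * ‖muPart z‖ ^ 2 / (1 - sOf z) * pFun κ (sOf z) := fun t => by
    rw [norm_lamPart_modelF_sq hκ (by rw [hs t]; exact hs1), uOf, hs t, normSq_muPart_line hvm]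
  have hd : HasDerivAt
      (fun t : ℝ => (1 + t * cm) ^ 2 * ‖muPart z‖ ^ 2 / (1 - sOf z) * pFun κ (sOf z))
      (2 * cm * ‖muPart z‖ ^ 2 / (1 - sOf z) * pFun κ (sOf z)) 0 := by
    have h := (((((hasDerivAt_id' (0 : ℝ)).mul_const cm).const_add 1).fun_pow 2).mul_const
      (‖muPart z‖ ^ 2)).div_const (1 - sOf z) |>.mul_const (pFun κ (sOf z))
    refine h.congr_deriv ?_
    simp only [Nat.cast_ofNat, zero_mul, add_zero, one_mul]
    ring
  have h1 := (hasDerivAt_parts_of_ker hF hv).1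
  have heq : (fun t : ℝ => ‖lamPart (modelF a κ δ (z + t • v))‖ ^ 2) =
      fun t => (1 + t * cm) ^ 2 * ‖muPart z‖ ^ 2 / (1 - sOf z) * pFun κ (sOf z) := funext hP
  rw [heq] at h1
  have h2 : 2 * cm * ‖muPart z‖ ^ 2 / (1 - sOf z) * pFun κ (sOf z) = 0 := hd.unique h1
  have hcm : cm * ‖muPart z‖ ^ 2 = 0 := by
    have hp : 0 < pFun κ (sOf z) := pFun_pos hκ (sq_nonneg _)
    rcases mul_eq_zero.1 h2 with h3 | h3
    · rcases div_eq_zero_iff.1 h3 with h4 | h4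
      · linarith
      · exact absurd h4 (by linarith)
    · exact absurd h3 hp.ne'
  -- `v_μ = 0`
  have hm : muPart v = 0 := by
    have h : ‖muPart v‖ ^ 2 = 0 := by
      rw [hvm, norm_smul, mul_pow, Real.norm_eq_abs, sq_abs]
      have e : cm ^ 2 * ‖muPart z‖ ^ 2 = cm * (cm * ‖muPart z‖ ^ 2) := by ring
      rw [e, hcm, mul_zero]
    exact norm_eq_zero.1 ((pow_eq_zero_iff two_ne_zero).1 h)
  rw [← lamEmbed_add_muEmbed v, hl, hm, lamEmbed_zero, muEmbed_zero, add_zero]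

/-- **Registered helper `helper_parts_of_ker_fderiv_modelF` (brick (F-emb-b) of T3b, sub-goal of
NF6 `stub_steinRealisation`, wave 3, lead c5): kernel vectors of the differential of the model
dual handle map have parts parallel to those of the base point.** [folklore] -/
theorem helper_parts_of_ker_fderiv_modelF : ∀ {a κ δ : ℝ}, 0 < κ → 0 < δ → δ ≤ 1 / 2 → ∀ {z : EuclideanSpace ℝ (Fin 4)}, z ∈ Summit.SmoothPoincare4.SmoothPoincare4.Theorems.AcyclicBisectionExists.ModpBraidOrbits.modelDom a κ δ → ∀ {F' : EuclideanSpace ℝ (Fin 4) →L[ℝ] EuclideanSpace ℝ (Fin 4)}, HasFDerivAt (Summit.SmoothPoincare4.SmoothPoincare4.Theorems.AcyclicBisectionExists.ModpBraidOrbits.modelF a κ δ) F' z → ∀ {v : EuclideanSpace ℝ (Fin 4)}, F' v = 0 → ∃ cl cm : ℝ, Literature.Topology.FourManifolds.lamPart v = cl • Literature.Topology.FourManifolds.lamPart z ∧ Literature.Topology.FourManifolds.muPart v = cm • Literature.Topology.FourManifolds.muPart z :=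
  fun hκ hδ hδ2 _ hz _ hF _ hv => parts_of_ker hκ hδ hδ2 hz hF hv

end Kernel

end Summit.SmoothPoincare4.SmoothPoincare4.Theorems.AcyclicBisectionExists.ModpBraidOrbits

end
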